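/-
pub-hubbard cell (planner pub-hubbard-r3, gen 14). Ladder R1–R4 with certified numbers; no claim on
`H`/`H₀`. This file certifies NO number.
-/
import Summits.HubbardSuperconductivity.HubbardLadder.PairSourceEnergySlack
import HarnessLib

/-!
# An energy-only R4⁻ certificate, route #2: the sourced-energy response

HONEST FRAMING (cell pub-hubbard, unit R3/R4). This file belongs to the ladder R1–R4 with certified
numbers; it makes NO claim on `H`/`H₀` (`Summit.HubbardSuperconductivity`) and it certifies NO number.
It TYPES a second energy-only certificate grammar for the R4⁻ target `NoDWaveOrderPureU8Eighth`
(companion of `PairGapCeiling.lean`, energy-only route #1 = pair incompressibility) and proves,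
sorry-free, that such a certificate implies a uniform ceiling on the `d_{x²-y²}` pair-field order
parameter. No instance of the certificate exists, none is claimed, and no producer of its two inputs
is chartered (R3 result line of record: no R3 instance has been run; no dichotomy is certified at any
size; there are no brackets to overlap).

## §1 The inequality

Koma–Tasaki / Kaplan–Horsch–von der Linden in EIGENVECTOR form. Let `K = K†`, `O = O†` act on a
finite-dimensional Hilbert space, `ψ` a normalised eigenvector `K ψ = E ψ` obeying the selection rules
`⟨ψ, O ψ⟩ = 0 = ⟨Oψ, O(Oψ)⟩`; put `q = ‖Oψ‖²` and `d = Re⟨ψ, [O,[O,K]] ψ⟩`. The trial vector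
`ψ + t·Oψ` in the variational principle for `K - hO` gives, for every real `t`,
`E₀(K - hO)(1 + t²q) ≤ E(1 + t²q) - 2thq - t²d/2` (`groundEnergy_source_mul_le_of_eigen`), and with
a slack `S ≥ E - E₀(K - hO)`, `S, h > 0`, the choice `t = h/S` yields
`q ≤ S²/h² + ‖[O,[O,K]]‖/(2S)` (`normSq_le_of_slack`).

## §2 The Hubbard torus

`K = H(1,U) - μN = hubbardTorusWith 2 L 1 U μ`, `O = Δ_d + Δ_d†`, `Δ_d = pairField dWaveFormFactor L`,
`K - hO = dWaveSourceTorus L U μ h`, and `ψ` a normalised ground state of `H(1,U)` in the sector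
`(N, S^z = 0)` (`IsGroundStateInSector`), so `E = E_N(L) - μN`. With the tree's graded-locality budgets
`‖[O,[O,K]]‖ ≤ B₂(1+|U|+|μ|)L²` (`kt_norm_doubleCommutator_le`) and
`2 Re⟨Δ_d†Δ_d⟩ ≤ ‖Oψ‖² + B_p L²` (`kt_two_mul_re_pair_le_re_order_sq`):
`2 Re⟨ψ, Δ_d†Δ_d ψ⟩ ≤ S²/h² + B₂(1+|U|+|μ|)L²/(2S) + B_p L²` for EVERY real `U, μ`, every `h > 0` and
every `S > 0` with
`(⋆)  E_N(L) - μN - E₀(H(1,U) - μN - h(Δ_d + Δ_d†)) ≤ S`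
(`two_mul_re_pair_le_of_sourcedSlack`). With `S = sL²` this is
`p_d(L; ψ) ≤ s²/(2h²) + [B₂(1+|U|+|μ|)/(4s) + B_p/2]/L²`.
Compared with the tree's `kt_trialStateBound` (summit route `AbsenceCertificate`, proved crux
`SourcedOrderDominatesLRO`: arbitrary normalised `N`-particle trial state, canonical-support
hypothesis, a `√e` cross term and an analytic constant surviving the limit) the eigenvector form has no
cross term, no canonical-support hypothesis (ANY `μ` is admissible; a bad `μ` only inflates `S`) and no
analytic constant in the `L → ∞` limit: the ceiling is `s²/(2h²)` exactly. The summit route's one-point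
order parameter is also controlled: `m_L(h/2) = dWaveSourceDensity L U μ (h/2) ≤ S/(hL²)`
(`dWaveSourceDensity_le_of_sourcedSlack`, from the tree's energy sandwich; no trial state needed).

## §3 The certificate and what it would need

`PairSourceEnergyCert U N`: reals `h > 0`, `μ`, `s > 0`, a side `L₀`, and (⋆) with `S = sL²` on every
even side `L ≥ L₀` at particle number `N L`. Proved consequences: a pointwise density bound
`p_d ≤ s²/(2h²) + C/L²` (`pairFieldDensity_le`), uniform ceiling certificates of every size
`> s²/(2h²)` (`exists_uniformCeilingCert`), hence `limsup_k σ_d²(2k) ≤ s²/(2h²)` along every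
admissible ground-state sequence (`limsup_dWaveOrderParamSq_le`), and `m_L(h/2) ≤ s/h`
(`dWaveSourceDensity_le`; an energy certificate with `s/h ≤ 1/20` would give the one-point ceiling of
`AbsenceCertificate.StripeSourceCeiling` at the source `h/2` without state-optimality rows — a
cross-pointer, not a claim). The two INPUTS of (⋆) are thermodynamic-limit-type ENERGY rows of the
cell's two engine classes: (a) an upper bound on the canonical sector energy `E_N(L) ≤ e⁺L²` uniform
in even `L ≥ L₀` (var: translation-invariant trial states; today only per-`L` rows and signed TL numbers
exist, e.g. `e(8, 7/8, t′ = 0) ≤ -0.6713374`; the uniform-in-`L` statement is undelivered); (b) a LOWER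
bound on the grand-canonical SOURCED energy `E₀(H(1,U) - μN - h(Δ_d + Δ_d†)) ≥ e⁻L²` uniform in `L`
(sdp: the translation-invariant energy hierarchy is uniform in `L` by construction, but the pair source
breaks particle-number conservation down to fermion parity — an engine extension that is NOT
chartered and no such campaign is named). Then `s = e⁺ - μρ - e⁻`, `ρ = 7/8` at `δ = 1/8`.

## Magnitudes (estimates, NOT certified)

`s = g⁺ + g(μ) + R(h) + g⁻` with `g±` the relaxation gaps of (a)/(b), `g(μ) ≥ 0` the canonical-support
defect of `μ` (zero at a supporting `μ`, which exists by convexity of `e(ρ)` but must be located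
numerically) and `R(h) = e_gc(μ,0) - e_gc(μ,h) ≤ 2h·m(h)` the true sourced energy response, `m(h)` the
infinite-volume induced pair amplitude (unknown). So the ceiling is `½(g/h + 2m(h))²`,
`g = g⁺ + g(μ) + g⁻`. Benchmarks in this normalisation: Yang's kinematic bound gives
`limsup σ_d² ≤ 63/32 ≈ 1.97` at `δ = 1/8` unconditionally (`limsup_dWaveOrderParamSq_le_yang_eighth`),
so a certificate is informative only if `g/h + 2m(h) < 1.98`; the physically interesting region
(DMRG/AFQMC-size pair correlations) is `σ_d² ≲ 10⁻²`, i.e. `g/h + 2m(h) ≲ 0.14`. Today's two-sided TL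
energy brackets at `(U, δ) = (8, 1/8)` are `0.25–0.36 t` wide WITHOUT a source. Illustrative rows
(assumed `m(h)` in brackets): `g = 0.30, h = 0.5 [0.5] → 1.28`; `g = 0.10, h = 0.25 [0.3] → 0.50`;
`g = 0.01, h = 0.05 [0.06] → 0.05`; `g = 10⁻³, h = 0.01 [0.012] → 0.008`. Verdict: passing the
kinematic value needs SOURCED two-sided brackets about three times tighter than today's unsourced
ones; a physically meaningful ceiling needs energy densities to `~10⁻³ t` (0.1 % of `|e| ≈ 0.77 t`),
beyond every engine of the cell. This is an R4 rung-type edge with every hypothesis explicit, nothing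
more. Robustness: unlike route #1 (`PairGapCeiling.lean`: three sector energies to `±0.1 t` at each
finite `L`) and the windows of `PairGapCeilingRows.lean`, (⋆) involves only energies per site, which
converge along all even `L`; the period-8 commensurability caveat recorded there does not arise.

## §4 The open node

`SmallPairSourceResponsePureU8Eighth` (OPEN, typed, NOT claimed): certificates with arbitrarily small
`s²/(2h²)` at `(U, δ) = (8, 1/8)`. It implies `NoDWaveOrderPureU8Eighth` and hence
(`PairGapCeiling.pureModelStripeCompetition_of_noDWaveOrderPureU8Eighth`) the barrier-catalogue
conjecture `PureModelStripeCompetition`. In the language of the summit route `AbsenceCertificate` it is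
an energy form of `CanonicalSupportingPotential ∧ StripeSourcedVanishing` (modulo constants); it is
recorded only as the cell's R4 statement with explicit hypotheses.

Sources. T. A. Kaplan, P. Horsch, W. von der Linden, J. Phys. Soc. Jpn. 58 (1989) 3894 (order
parameter from the response to a symmetry-breaking field); T. Koma, H. Tasaki, J. Stat. Phys. 76
(1994) 745, Theorem 2.2 and §1 (LRO ⇒ symmetry breaking under an infinitesimal source; the
double-commutator trial state); H. Tasaki, H. Watanabe (2021) (energy–LRO inequalities of this type);
M. Qin et al., Phys. Rev. X 10 (2020) 031016, §IV (the regime `U = 8`, `δ = 1/8`; pairing response).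

FILE SPLIT (literature seat, `lint.size` ≤ 400 lines): §1–§2
(`groundEnergy_source_mul_le_of_eigen`, `normSq_le_of_slack`,
`two_mul_re_pair_le_of_sourcedSlack`, `dWaveSourceDensity_le_of_sourcedSlack`) are in the imported
module `Summits.HubbardSuperconductivity.HubbardLadder.PairSourceEnergySlack`; this module keeps
§3–§4. All declarations are byte-identical to r3 g14's staged `PairSourceEnergyCeiling.lean`.
-/

noncomputable section

namespace Summit.HubbardSuperconductivity.HubbardLadder

open Matrix Filter Literature.Probability.LatticeModels
open Literature.MathematicalPhysics.QuantumLattice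
open Literature.Barriers.HubbardSuperconductivity (PureModelStripeCompetition)
open Summit.HubbardSuperconductivity.HubbardSuperconductivity.Theorems.WcbcsTrialState
open Summit.HubbardSuperconductivity.HubbardSuperconductivity.Theorems.AbsenceCertificate
  (kt_norm_doubleCommutator_le kt_two_mul_re_pair_le_re_order_sq
    kt_isNParticle_of_groundStateInSector kt_re_expect_hubbardTorusWith)
open scoped Matrix.Norms.L2Operator ComplexOrder Topology

/-! ## §3 The certificate and its consequences -/

/-- **R4-format PAIR-SOURCE ENERGY certificate** for the pure Hubbard family `H(1,U)` at particle
numbers `N L`: a source strength `h > 0`, a chemical potential `μ`, a slack density `s > 0` and a side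
`L₀` such that on every even side `L ≥ L₀` (with `L ≥ 1`)
`E_{N L}(L) - μ·N L - E₀(H(1,U) - μN - h(Δ_d + Δ_d†)) ≤ s L²`.
Its two inputs are an upper bound on the canonical sector energy (variational) and a lower bound on
the grand-canonical sourced energy (e.g. a moment/SDP relaxation WITH the pair source), both uniform in
`L`; neither exists today. [cite: KaplanHorschVonDerLinden1989] [cite: KomaTasaki1994, §1] -/
structure PairSourceEnergyCert (U : ℝ) (N : ℕ → ℕ) where
  /-- the source strength -/
  h : ℝ
  h_pos : 0 < h
  /-- the chemical potential of the grand-canonical lower bound -/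
  μ : ℝ
  /-- the slack density -/
  s : ℝ
  s_pos : 0 < s
  /-- the side from which the rows hold -/
  L₀ : ℕ
  bound : ∀ (L : ℕ) [NeZero L], L₀ ≤ L → Even L →
    (hubbardTorus 2 L 1 U).minEnergyOn (szSector (N L) 0) - μ * (N L) -
      (dWaveSourceTorus L U μ h).groundEnergy ≤ s * (L : ℝ) ^ 2

namespace PairSourceEnergyCert

variable {U : ℝ} {N : ℕ → ℕ} (c : PairSourceEnergyCert U N)

/-- The ceiling constant `s²/(2h²)` of the certificate. [folklore] -/
def ceiling : ℝ := c.s ^ 2 / (2 * c.h ^ 2)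

/-- The ceiling constant is non-negative. [folklore] -/
theorem ceiling_nonneg : 0 ≤ c.ceiling := by
  unfold ceiling; positivity

/-- **Pointwise density bound from the certificate**: there is `C ≥ 0` (depending on `U, μ, s` through
the tree's budgets) with `p_d(L; ψ) ≤ s²/(2h²) + C/L²` for every normalised sector ground state `ψ`
on every even side `L ≥ max L₀ 1`. [cite: KomaTasaki1994, Theorem 2.2] -/
theorem pairFieldDensity_le : ∃ C : ℝ, 0 ≤ C ∧ ∀ (L : ℕ), c.L₀ ≤ L → 1 ≤ L → Even L →
    ∀ ψ : Fock (Orb (FermionTorus 2 L)), star ψ ⬝ᵥ ψ = 1 →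
      IsGroundStateInSector (pureHubbard U L) (N L) 0 ψ →
      pairFieldDensity L ψ ≤ c.ceiling + C / (L : ℝ) ^ 2 := by
  obtain ⟨B₂, Bp, hB₂, hBp, hmain⟩ := two_mul_re_pair_le_of_sourcedSlack
  have hs := c.s_pos
  have hh := c.h_pos
  refine ⟨B₂ * (1 + |U| + |c.μ|) / (4 * c.s) + Bp / 2, by positivity,
    fun L hL hL1 hLe ψ hψ1 hgs => ?_⟩
  haveI : NeZero L := ⟨by omega⟩
  have hLpos : (0 : ℝ) < (L : ℝ) := by exact_mod_cast (show 0 < L by omega)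
  have hSL : 0 < c.s * (L : ℝ) ^ 2 := by positivity
  have key := hmain L U c.μ c.h (c.s * (L : ℝ) ^ 2) hh hSL (N L) ψ hψ1 hgs (c.bound L hL hLe)
  obtain ⟨L', rfl⟩ : ∃ L', L = L' + 1 := ⟨L - 1, by omega⟩
  set ℓ : ℝ := ((L' + 1 : ℕ) : ℝ) with hℓ
  have hℓ0 : (0 : ℝ) < ℓ := by positivity
  have hℓ1 : (1 : ℝ) ≤ ℓ := by rw [hℓ]; exact_mod_cast hL1
  have hℓ2 : (1 : ℝ) ≤ ℓ ^ 2 := by nlinarith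
  have hS' : pairFieldDensity (L' + 1) ψ =
      (expect ((pairField dWaveFormFactor (L' + 1))ᴴ * pairField dWaveFormFactor (L' + 1)) ψ).re /
        ℓ ^ 4 := rfl
  rw [hS']
  set R : ℝ := (expect ((pairField dWaveFormFactor (L' + 1))ᴴ *
    pairField dWaveFormFactor (L' + 1)) ψ).re with hR
  have hs0 : c.s ≠ 0 := hs.ne'
  have hh0 : c.h ≠ 0 := hh.ne'
  have hℓne : ℓ ≠ 0 := hℓ0.ne'
  have e1 : B₂ * (1 + |U| + |c.μ|) * ℓ ^ 2 / (2 * (c.s * ℓ ^ 2)) =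
      B₂ * (1 + |U| + |c.μ|) / (2 * c.s) := by
    field_simp
    try ring
  have e2 : (c.s * ℓ ^ 2) ^ 2 / c.h ^ 2 = 2 * (c.ceiling * ℓ ^ 4) := by
    unfold ceiling
    field_simp
    try ring
  rw [e1, e2] at key
  have hA : 0 ≤ B₂ * (1 + |U| + |c.μ|) / (4 * c.s) := by positivity
  have hAℓ : B₂ * (1 + |U| + |c.μ|) / (4 * c.s) ≤ B₂ * (1 + |U| + |c.μ|) / (4 * c.s) * ℓ ^ 2 :=
    le_mul_of_one_le_right hA hℓ2
  have hRle : R ≤ c.ceiling * ℓ ^ 4 + (B₂ * (1 + |U| + |c.μ|) / (4 * c.s) + Bp / 2) * ℓ ^ 2 := by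
    have e3 : B₂ * (1 + |U| + |c.μ|) / (2 * c.s) = 2 * (B₂ * (1 + |U| + |c.μ|) / (4 * c.s)) := by
      field_simp
      try ring
    rw [e3] at key
    nlinarith
  calc R / ℓ ^ 4
      ≤ (c.ceiling * ℓ ^ 4 + (B₂ * (1 + |U| + |c.μ|) / (4 * c.s) + Bp / 2) * ℓ ^ 2) / ℓ ^ 4 :=
        div_le_div_of_nonneg_right hRle (by positivity)
    _ = c.ceiling + (B₂ * (1 + |U| + |c.μ|) / (4 * c.s) + Bp / 2) / ℓ ^ 2 := by
        field_simp
        try ring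

/-- **Uniform ceiling certificates of every size above `s²/(2h²)`.** For every `η > 0` the
certificate yields a `UniformPairFieldCeilingCert (pureHubbard U) N` with constant `s²/(2h²) + η`
(absorb `C/L² ≤ η` from a computable side on). [cite: KomaTasaki1994, Theorem 2.2] -/
theorem exists_uniformCeilingCert {η : ℝ} (hη : 0 < η) :
    ∃ u : UniformPairFieldCeilingCert (pureHubbard U) N, u.ε = c.ceiling + η := by
  obtain ⟨C, hC0, hC⟩ := c.pairFieldDensity_le
  obtain ⟨L₁, hL₁⟩ := exists_nat_gt (C / η)
  refine ⟨⟨c.ceiling + η, max c.L₀ (max L₁ 1), fun L hL hLe ψ hψ1 hgs => ?_⟩, rfl⟩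
  have hL0 : c.L₀ ≤ L := le_trans (le_max_left _ _) hL
  have hL1 : 1 ≤ L := le_trans ((le_max_right _ _).trans (le_max_right _ _)) hL
  have hLL : L₁ ≤ L := le_trans ((le_max_left _ _).trans (le_max_right _ _)) hL
  refine (hC L hL0 hL1 hLe ψ hψ1 hgs).trans ?_
  have hLr : C / η < (L : ℝ) := hL₁.trans_le (by exact_mod_cast hLL)
  have hL1r : (1 : ℝ) ≤ L := by exact_mod_cast hL1
  have hCL : C < (L : ℝ) * η := (div_lt_iff₀ hη).1 hLr
  have hηL : (L : ℝ) * η ≤ η * (L : ℝ) ^ 2 := by nlinarith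
  have hdiv : C / (L : ℝ) ^ 2 ≤ η := by
    rw [div_le_iff₀ (by positivity)]
    linarith
  linarith

/-- **limsup of the order parameter under the certificate**: along every admissible ground-state
sequence of `(pureHubbard U, N)` (even tori, `S^z = 0`, normalised),
`limsup_k dWaveOrderParamSq ψ k ≤ s²/(2h²)`. [cite: KomaTasaki1994, Theorem 2.2]
[cite: KaplanHorschVonDerLinden1989] -/
theorem limsup_dWaveOrderParamSq_le (ψ : ∀ L, Fock (Orb (FermionTorus 2 L)))
    (hψ : ∀ L, Even L → star (ψ L) ⬝ᵥ ψ L = 1 ∧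
      IsGroundStateInSector (pureHubbard U L) (N L) 0 (ψ L)) :
    limsup (dWaveOrderParamSq ψ) atTop ≤ c.ceiling := by
  refine le_of_forall_pos_le_add fun η hη => ?_
  obtain ⟨u, hu⟩ := c.exists_uniformCeilingCert hη
  rw [← hu]
  exact u.limsup_dWaveOrderParamSq_le ψ hψ

/-- **The certificate bounds the summit route's one-point order parameter**: on every even side
`L ≥ max L₀ 1` on which the sector `(N L, S^z = 0)` has a normalised ground state,
`dWaveSourceDensity L U μ (h/2) ≤ s/h`. (A sector ground state exists whenever the sector is
non-trivial, `exists_groundStateSeq_pure`-style; kept as a hypothesis to stay model-agnostic in `N`.)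
[cite: KomaTasaki1994, §1] -/
theorem dWaveSourceDensity_le (L : ℕ) [NeZero L] (hL : c.L₀ ≤ L) (hLe : Even L)
    {ψ : Fock (Orb (FermionTorus 2 L))} (hψ1 : star ψ ⬝ᵥ ψ = 1)
    (hgs : IsGroundStateInSector (pureHubbard U L) (N L) 0 ψ) :
    dWaveSourceDensity L U c.μ (c.h / 2) ≤ c.s / c.h := by
  have hh := c.h_pos
  have hL0 : (0 : ℝ) < (L : ℝ) := by exact_mod_cast Nat.pos_of_ne_zero (NeZero.ne L)
  have key := dWaveSourceDensity_le_of_sourcedSlack L U c.μ c.h (c.s * (L : ℝ) ^ 2) hψ1 hgs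
    (c.bound L hL hLe)
  rw [le_div_iff₀ hh]
  have : dWaveSourceDensity L U c.μ (c.h / 2) * c.h * (L : ℝ) ^ 2 ≤ c.s * (L : ℝ) ^ 2 := by
    nlinarith
  exact le_of_mul_le_mul_right this (by positivity)

end PairSourceEnergyCert

/-! ## §4 The open node at `(U, δ) = (8, 1/8)` and the links to the targets -/

/-- OPEN (typed, NOT claimed; no instance is known and none is requested) — **small sourced-energy
response of the pure 2D Hubbard model at `U/t = 8`, hole doping `1/8`**: for every `ε > 0` there are
`h > 0`, `μ`, `s > 0` with `s²/(2h²) ≤ ε` and a side `L₀` such that on every even torus of side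
`L ≥ L₀` the canonical ground-state energy at `N_L = 2⌊(7/8)L²/2⌋` electrons exceeds the
grand-canonical ground-state energy of `H(1,8) - μN - h(Δ_d + Δ_d†)` by at most `sL² + μN_L`
(`PairSourceEnergyCert`). An energy-language form of "no `d`-wave symmetry breaking under an
infinitesimal pair source at a supporting chemical potential" (compare the summit route
`AbsenceCertificate`: `CanonicalSupportingPotential`, `StripeSourcedVanishing`). It IMPLIES the cell
target `NoDWaveOrderPureU8Eighth` (below); nothing here asserts it.
[cite: QinEtAl2020, §IV p. 11] [cite: KomaTasaki1994, §1] [status: open] -/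
@[conjecture] def SmallPairSourceResponsePureU8Eighth : Prop :=
  ∀ ε > 0, ∃ c : PairSourceEnergyCert 8 (electronNumber (1 / 8)), c.ceiling ≤ ε

/-- **Certificates of every size ⇒ uniform ceilings of every size** (`SmallPairSourceResponse` in
words: for every `ε > 0` a `PairSourceEnergyCert U N` with `s²/(2h²) ≤ ε`). [cite: KomaTasaki1994,
Theorem 2.2] -/
theorem exists_uniformCeilingCert_of_smallPairSourceResponse {U : ℝ} {N : ℕ → ℕ}
    (h : ∀ ε > 0, ∃ c : PairSourceEnergyCert U N, c.ceiling ≤ ε) :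
    ∀ ε > 0, ∃ cert : UniformPairFieldCeilingCert (pureHubbard U) N, cert.ε ≤ ε := by
  intro ε hε
  obtain ⟨c, hc⟩ := h (ε / 2) (half_pos hε)
  obtain ⟨u, hu⟩ := c.exists_uniformCeilingCert (half_pos hε)
  exact ⟨u, by rw [hu]; linarith⟩

/-- **Certificates of every size ⇒ R4⁻ for `(H(1,U), N)`**: the order parameter of every admissible
ground-state sequence tends to `0`. [cite: KomaTasaki1994, Theorem 2.2]
[cite: KaplanHorschVonDerLinden1989] -/
theorem tendsto_zero_of_smallPairSourceResponse {U : ℝ} {N : ℕ → ℕ}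
    (h : ∀ ε > 0, ∃ c : PairSourceEnergyCert U N, c.ceiling ≤ ε)
    (ψ : ∀ L, Fock (Orb (FermionTorus 2 L)))
    (hψ : ∀ L, Even L → star (ψ L) ⬝ᵥ ψ L = 1 ∧
      IsGroundStateInSector (pureHubbard U L) (N L) 0 (ψ L)) :
    Tendsto (dWaveOrderParamSq ψ) atTop (𝓝 0) :=
  UniformPairFieldCeilingCert.tendsto_zero_of_forall
    (exists_uniformCeilingCert_of_smallPairSourceResponse h) ψ hψ

/-- **The open node implies the cell target H⁻** (`NoDWaveOrderPureU8Eighth`).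
[cite: QinEtAl2020, §IV p. 11] -/
theorem noDWaveOrderPureU8Eighth_of_smallPairSourceResponse
    (h : SmallPairSourceResponsePureU8Eighth) : NoDWaveOrderPureU8Eighth := by
  intro N ψ hNψ
  have hψ : ∀ L, Even L → star (ψ L) ⬝ᵥ ψ L = 1 ∧
      IsGroundStateInSector (pureHubbard 8 L) (electronNumber (1 / 8) L) 0 (ψ L) := by
    intro L hL
    obtain ⟨hN, h1, hgs⟩ := hNψ L hL
    rw [hN] at hgs
    exact ⟨h1, hgs⟩
  exact tendsto_zero_of_smallPairSourceResponse h ψ hψ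

/-- **The open node implies the barrier-catalogue conjecture** `PureModelStripeCompetition`
(via `pureModelStripeCompetition_of_noDWaveOrderPureU8Eighth`). [cite: QinEtAl2020, §IV p. 11] -/
theorem pureModelStripeCompetition_of_smallPairSourceResponse
    (h : SmallPairSourceResponsePureU8Eighth) : PureModelStripeCompetition :=
  pureModelStripeCompetition_of_noDWaveOrderPureU8Eighth
    (noDWaveOrderPureU8Eighth_of_smallPairSourceResponse h)

/-- **Quantitative form at `(8, 1/8)`**: a single certificate `c` bounds the order parameter of every
admissible ground-state sequence of the pure model at `U = 8`, `δ = 1/8` by `c.s²/(2c.h²)` in `limsup`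
— to be compared with the unconditional kinematic value `63/32`
(`limsup_dWaveOrderParamSq_le_yang_eighth`). [cite: KomaTasaki1994, Theorem 2.2] -/
theorem limsup_dWaveOrderParamSq_le_of_pairSourceEnergyCert
    (c : PairSourceEnergyCert 8 (electronNumber (1 / 8)))
    (N : ℕ → ℕ) (ψ : ∀ L, Fock (Orb (FermionTorus 2 L)))
    (hNψ : ∀ L, Even L → N L = 2 * ⌊(1 - 1 / 8) * (L : ℝ) ^ 2 / 2⌋₊ ∧ star (ψ L) ⬝ᵥ ψ L = 1 ∧
        IsGroundStateInSector (hubbardTorus 2 L 1 8) (N L) 0 (ψ L)) :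
    limsup (dWaveOrderParamSq ψ) atTop ≤ c.s ^ 2 / (2 * c.h ^ 2) := by
  refine c.limsup_dWaveOrderParamSq_le ψ fun L hL => ?_
  obtain ⟨hN, h1, hgs⟩ := hNψ L hL
  rw [hN] at hgs
  exact ⟨h1, hgs⟩

end Summit.HubbardSuperconductivity.HubbardLadder

end
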